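import Summits.RiemannHypothesis.RiemannHypothesis.Theorems.TiltedLandingLaw421R3Lens1Pinning

/-!
# W-08 ▸ lens-2 ▸ CREDIT NET BOOKS v7 r2 (token 80, (CA886)(A): the honest coarsest typed cut on the tree socket; files-only image, registry-neutral)

THESIS (rate side of ⟨33346⟩ at the half purse).  The target `RestRateBotPQ halfPurse` is, level by level, the books
`netCostQ ⊤ (k+1) ≤ slackPQ halfPurse + creditsQ (k+1)` (tree `restRateBotPQ_iff_books_step`, …R3PurseBooks :105), and

  `creditsQ k = min (T₀, injected k)`                                   (§1, K: `creditsQ_eq_min`)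

where `injected k` counts the CHARGED levels `j < k` whose lowest's closed 3/2-tent is NON-EMPTY (tree `injected`, …E3Lineage :134, with
the class `EmptyTrkDQ` = «`tentAt (3/2) f j u < 1` at a lowest u», …R2TrkD :34 / …R3QuadW :34): every charged CROWDED level is REFUNDED one
unit, up to `T₀`.  v6 r2 (NEG 12, (CA874)) discarded exactly these refunds (`creditsQ_nonneg` in its kernel) and priced the horizon against
`slack_½ = … − T₀`; on the comb family the refunds are the whole payer (lens-2 memo CREDIT-READING-v1 053d9e1672adc1d1, §R3–R4: on COMB-λ,
λ = 2…12, every charged level is crowded and `injected = chargeCount ≤ T₀`, so the books read `−cds ≤ slack_½`; the credits-FREE price —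
v6's FIT⁗ and equally any «(1 − 4·drop/s)⁺ against slack_½» pricing — goes negative from λ = 8 on: −1.42 / −3.32 / −5.26 at λ = 8 / 10 / 12,
exact-sign tracker `comb_lambda2.py` 72869377af29de4b, legality of λ ≥ 3 pending crit-1's clause-16 certificate).

THE CUT (an instance of the TREE's class socket `restRateBotPQ_of_threeBooks_ge`, …R3PurseBooks :165, with the coarsest classes and
PROPORTIONAL capital; no energy law, no floor, no lift):
* LAW A `EmptyNetLawQ κ`     := `ClassLawQ EmptyTrkDQ (κ · slackPQ halfPurse)` — the charged EMPTY-tent levels, net of their own signed sinks,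
                                 cost at most the share κ of the half slack;
* LAW B `CrowdedCreditLawQ κ` := `CreditLawQ CrowdedQ ((1 − κ) · slackPQ halfPurse)`, `CrowdedQ := diffClass AllLevelsQ EmptyTrkDQ` — the charged
                                 CROWDED levels, net of their sinks, cost at most the refunds `creditsQ` plus the share 1 − κ;
* (K) the rest class `restClass EmptyTrkDQ AllLevelsQ` is empty, the capital `κS + (1−κ)S + 0 ≤ S` is an identity, INIT is `typedPurse ≤ halfPurse`.
Kernel `restRateBotPQ_half_of_creditNet κ : EmptyNetLawQ κ → CrowdedCreditLawQ κ → RestRateBotPQ halfPurse`; read-back `law421R_of_creditNet`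
concludes the crux decl `…Theses.EarlyAppointments.TiltedLandingLaw421R` BY NAME from `TopPinning`, `RegUmbrella11S`, LAW A, LAW B (κ₀ = 1/2 of
record: `EmptyNetLawHalfQ`, `CrowdedCreditLawHalfQ`, `law421R_of_creditNet_half`).  PURSE-SHAPED, NOT LOCAL: the allowances are GLOBAL SHARES κ·S of the
half-purse slack, not functions of level data — this file does NOT meet (CA876)(C) (memo LOCAL-OMEGA-v1 a723f3c7 = DESIGN NOTE 4 says why no local law with a
proved summation is in hand); it is the honest coarsest CLASS SPLIT of the target's own books.  §4 (K) `restRateBotPQ_half_iff_sum`: the target is EXACTLY the κ-free SUM of the two laws' left sides —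
so A(κ) ∧ B(κ) is a genuine strengthening-by-split (each law alone is NOT a consequence of the target; each is killable on its own).

RELATION TO THE REGISTRY (v11q, `RhW08.RateSplit.RateLawsHalfCapQ`): same socket, coarser classes (`EmptyTrkDQ = Far ∪ Approach` side versus
`ConsLevelQ = ¬EmptyTrkDQ`, …R3RateBooksQ1b :28), budgets proportional to `slackPQ halfPurse` instead of (energy purse, aR, aC, residual).
Nothing of v11q is touched; this is a sibling rate-side cut, two typed-open stubs instead of four.

κ-WINDOWS (r2, (CA886)(A); pencil over exact ledgers — crit-1 LEDGER1 faa5484a, lens-2 comb2_lam*.txt, rim40_rho19_t3.txt f79d5728, rim50_rho145_t3.txt 48ef8dda,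
CUT47b/CUT48/R4K; indicative, never lemmas).  S := slackPQ halfPurse = slack0Q + (B+1)/2.  A(κ) needs netCost_Empty ≤ κS; B(κ) needs netCost_Crowded ≤ creditsQ + (1−κ)S.
B is taken at its COLUMN MINIMUM (clause 12 at r → 0 / at the rim radius) — the adversarial choice; legal frames of record have larger B (R4K: 1249/2499), i.e. wider windows.
| bench | charged levels (class) | A(κ) needs | B(κ) needs | window |
|---|---|---|---|---|
| COMB-2 / COMB-4 (NEG 12 / NEG 13 frames) | 9 / 13, all CROWDED, injected ≤ T₀ (T_j = T₀ − j ± 1) | vacuous | −cds ≤ (1−κ)S: any κ ≤ 1 (defect < 1 = refund per level) | [0, 1] |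
| COMB-8 / COMB-12 (lens-2) | 33 / 49 crowded, injected < T₀ = 6λ+1 | vacuous | any κ ≤ 1 | [0, 1] |
| RIM-50 at 1.45h₀ (T₀ = 100; rim exits the tent at j = 0, released zeros re-crowd it: T_j = 1, 2, …, 13) | ≥ 20 crowded, defect .64 each, credits = injected | vacuous | any κ ≤ 1 | [0, 1] |
| RIM-40 at 1.9h₀ (T₀ = 0; B_min 71, t 3, S 117) | 1 empty (.34) + 17 crowded (Σ 6.3), credits ≡ 0 | κ ≥ .003 | κ ≤ .946 | [.003, .946] |
| HOVER-M, empty tent (M-fold pair at the ceiling; B_min = 2M − 2, T₀ 0) | M − 1 empty, drop 0, defect 1 each | κ ≥ (M−1)/(t² + 3M − 3/2) < 1/3 (HOVER-100, t 2: .327) | vacuous | [1/3, 1] |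
| HOVER-in-crowd (one central tooth: T₀ = 1, B_min = 2M − 1) | M − 2 crowded, defect 1 each, credits 1 | vacuous | κ ≤ 1 − (M−3)/(t² + 3M − 1) > 2/3 (M 20: .730; M 100: .680) | [0, 2/3] |
| tall columns X (CUT 47b: ≤ 6 charged, cds −13.0/−20.5/−13.8, half 55.5/70.5/77 ⇒ S ≥ 170) | netCost ≤ 26.5, either class | κ ≥ .16 if empty | κ ≤ .84 if crowded | ⊇ [.16, .84] |
| S* family (CUT 47b: netCost ≤ 6.6, B ≥ 31 ⇒ S ≥ 52), F*, X3 (CAND 10, CUT 47) | ≤ 6 | κ ≥ .13 | κ ≤ .87 | ⊇ [.13, .87] |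
| TE* (CUT 48: 4 deep charged levels, rising 2.5e-5/level, B 2499) | netCost 4.1 | trivial | trivial | ≈ [0, 1] |
INTERSECTION = [1/3, 2/3] (binding: adversarial-B HOVER-M from below, HOVER-in-crowd from above; asymptotic in M, exact bounds strictly inside); NOT a razor.
κ₀ := 1/2 = MID-WINDOW (checklist 4c(iv)): both binding benches keep margin S/6.  The typed laws of record are `EmptyNetLawHalfQ` / `CrowdedCreditLawHalfQ` (§2).
Why the window is not empty: braking a lowest to a charged sink needs zero mass above the free density 2/s near its column (free density alone sinks it ≥ 1.18 qs
per level), and that mass is what B counts — once for A's payers (non-real companions / crowds: multiplicity ≤ B/2 against S ≥ 3B/2) and once for B's (in-tent teeth,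
refunded one per charged crowded level up to T₀; beyond T₀ the column capital again).  Memo LOCAL-OMEGA-v1 a723f3c7 §5–§6 has the payer analysis.

HONEST LABEL: LAW A and LAW B are OPEN (typed sockets, account-shaped, no mechanism claimed); §1, §3, §4 are K.  IMAGE CANDIDATE, registry-neutral:
the skeleton OF RECORD stays `Lines/trkD_v11q.lean` e5f3c2cea72a0413.  ONE TREE import `…R3Lens1Pinning`.  Nothing here bears on the truth of RH;
RH is not proved; 33346/33347 OPEN; checked ≠ landed ≠ proved. -/

namespace RhW08.CreditBooks

open RhW08.Round1 RhW08.StSwap RhW08.Round2 RhW08.QuadW RhW08.SealSwapQ RhW08.PurseP RhIdea6.G17.W07C7 RhIdea6.G17.W07C7.Rev6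
open RhW08.SealSwap (PBot)
open RhIdea6.G18.W07C8.Law421BirthS RhIdea6.G19.W07C11.Seam RhIdea6.G20.W07C12.Frac RhIdea6.G20.W07C12.StColP RhW07.C12.FieldSplit RhW07.C14.TwoSided RhW07.C14.Classes
open RhW07.C14.Booking

/-! ## §1 (K) the credit reading: `creditsQ = min (T₀, injected)` -/

/-- (K) §1 **THE CREDIT READING**: the credits drawn below `k` are `min (T₀, injected k)` — one unit per charged CROWDED level, capped at the level-0 tent count. -/
theorem creditsQ_eq_min (η : ℝ) (f : ℂ → ℂ) (x₀ s hmax R Hs : ℝ) (B k : ℕ) :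
    creditsQ η f x₀ s hmax R Hs B k
      = min (tentMeterTrkD (3 / 2) η f x₀ s hmax R Hs B 0) (injected (PTrkSQ PBot) StTrkDQ ReadyR2 EmptyTrkDQ η f x₀ s hmax R Hs B k) := by
  have hT := tentMeterTrkD_nonneg (3 / 2) η f x₀ s hmax R Hs B 0
  have hi := injected_nonneg (PTrkSQ PBot) StTrkDQ ReadyR2 EmptyTrkDQ η f x₀ s hmax R Hs B k
  unfold creditsQ
  rw [max_eq_left hT]
  rcases le_total (tentMeterTrkD (3 / 2) η f x₀ s hmax R Hs B 0)
      (injected (PTrkSQ PBot) StTrkDQ ReadyR2 EmptyTrkDQ η f x₀ s hmax R Hs B k) with h | h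
  · rw [min_eq_left h, max_eq_right (by linarith)]
    ring
  · rw [min_eq_right h, max_eq_left (by linarith)]
    ring

/-- (K) §1 REFUND regime: while the injections do not exceed `T₀`, every charged crowded level is refunded (`creditsQ = injected`). -/
theorem creditsQ_eq_injected_of_le {η : ℝ} {f : ℂ → ℂ} {x₀ s hmax R Hs : ℝ} {B k : ℕ}
    (h : injected (PTrkSQ PBot) StTrkDQ ReadyR2 EmptyTrkDQ η f x₀ s hmax R Hs B k ≤ tentMeterTrkD (3 / 2) η f x₀ s hmax R Hs B 0) :
    creditsQ η f x₀ s hmax R Hs B k = injected (PTrkSQ PBot) StTrkDQ ReadyR2 EmptyTrkDQ η f x₀ s hmax R Hs B k := by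
  rw [creditsQ_eq_min, min_eq_right h]

/-- (K) §1 CAP regime: once the injections reach `T₀`, the credits are exhausted at `T₀` (`creditsQ = T₀`). -/
theorem creditsQ_eq_tent0_of_le {η : ℝ} {f : ℂ → ℂ} {x₀ s hmax R Hs : ℝ} {B k : ℕ}
    (h : tentMeterTrkD (3 / 2) η f x₀ s hmax R Hs B 0 ≤ injected (PTrkSQ PBot) StTrkDQ ReadyR2 EmptyTrkDQ η f x₀ s hmax R Hs B k) :
    creditsQ η f x₀ s hmax R Hs B k = tentMeterTrkD (3 / 2) η f x₀ s hmax R Hs B 0 := by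
  rw [creditsQ_eq_min, min_eq_left h]

/-! ## §2 (T) the two laws: tent classes, proportional shares of the half slack -/

/-- §2 the SHARE `κ · slackPQ halfPurse` (a `Budget`; tree `scaleBudgetQ`). -/
noncomputable def shareQ (κ : ℝ) : Budget := scaleBudgetQ κ (slackPQ halfPurse)

/-- §2 the CROWDED class: levels whose lowest's closed 3/2-tent is non-empty (`⊤ ∖ EmptyTrkDQ`, the shape the class socket wants). -/
def CrowdedQ : LevelClass := diffClass AllLevelsQ EmptyTrkDQ

/-- ★ (T, OPEN) §2 **LAW A — EMPTY-TENT NET LAW (share κ)**: after every charged level, the charged EMPTY-tent levels so far, net of their own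
signed sinks `4·dropQ/s`, cost at most `κ · slackPQ halfPurse`. -/
def EmptyNetLawQ (κ : ℝ) : Prop := ClassLawQ EmptyTrkDQ (shareQ κ)

/-- ★ (T, OPEN) §2 **LAW B — CROWDED CREDIT LAW (share 1 − κ)**: after every charged level, the charged CROWDED levels so far, net of their
sinks, cost at most the refunds `creditsQ` (one per charged crowded level up to `T₀`, §1) plus `(1 − κ) · slackPQ halfPurse`. -/
def CrowdedCreditLawQ (κ : ℝ) : Prop := CreditLawQ CrowdedQ (shareQ (1 - κ))

/-- ★ (T, OPEN) §2 LAW A OF RECORD at the mid-window share `κ₀ = 1/2` (κ-window [1/3, 2/3], header). -/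
def EmptyNetLawHalfQ : Prop := EmptyNetLawQ (1 / 2)

/-- ★ (T, OPEN) §2 LAW B OF RECORD at the mid-window share `κ₀ = 1/2`. -/
def CrowdedCreditLawHalfQ : Prop := CrowdedCreditLawQ (1 / 2)

/-! ## §3 (K) the kernel on the tree's class socket and the read-back to the crux by name -/

/-- (K) §3 the rest class `¬Empty ∧ ¬⊤` has no levels: its net cost vanishes. -/
theorem netCostQ_rest_eq_zero (η : ℝ) (f : ℂ → ℂ) (x₀ s hmax R Hs : ℝ) (B k : ℕ) :
    netCostQ (restClass EmptyTrkDQ AllLevelsQ) η f x₀ s hmax R Hs B k = 0 :=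
  netCostQ_eq_zero_of_forall_not fun _ _ _ h => h.2 trivial

/-- (K) §3 hence the rest class obeys the zero allowance. -/
theorem classLawQ_rest_zero : ClassLawQ (restClass EmptyTrkDQ AllLevelsQ) (budgetConst 0) := by
  intro η f x₀ s hmax R Hs B _ k _
  rw [netCostQ_rest_eq_zero]
  exact le_rfl

/-- (K) §3 CAPITAL: the shares `κ`, `1 − κ` and `0` add up to the half slack exactly. -/
theorem capitalLawPQ_shares (κ : ℝ) : CapitalLawPQ halfPurse (shareQ κ) (shareQ (1 - κ)) (budgetConst 0) := by
  intro η f x₀ s hmax R Hs B _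
  simp only [shareQ, scaleBudgetQ, budgetConst]
  linarith

/-- ★★ (K) §3 **THE KERNEL**: LAW A(κ) and LAW B(κ) pay `RestRateBotPQ halfPurse` (tree `restRateBotPQ_of_threeBooks_ge` with 𝓕 := EmptyTrkDQ,
𝓒 := ⊤, INIT from `typedPurse ≤ halfPurse`). -/
theorem restRateBotPQ_half_of_creditNet (κ : ℝ) (hA : EmptyNetLawQ κ) (hB : CrowdedCreditLawQ κ) : RestRateBotPQ halfPurse :=
  restRateBotPQ_of_threeBooks_ge (fun f x₀ s hmax R Hs B _ => typedPurse_le_halfPurse f x₀ s hmax R Hs B)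
    hA hB classLawQ_rest_zero (capitalLawPQ_shares κ)

/-- ★★★ (K) §3 **READ-BACK TO THE CRUX BY NAME**: `TopPinning`, `RegUmbrella11S` (SUCC side, landed chain) and LAW A(κ), LAW B(κ) conclude
`…Theses.EarlyAppointments.TiltedLandingLaw421R`. -/
theorem law421R_of_creditNet (hP : RhW08.Lens1Pinning.TopPinning) (hU : RhW08.Lens1Pinning.RegUmbrella11S)
    (κ : ℝ) (hA : EmptyNetLawQ κ) (hB : CrowdedCreditLawQ κ) :
    Summit.RiemannHypothesis.RiemannHypothesis.Theses.EarlyAppointments.TiltedLandingLaw421R :=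
  law421Half_of_succ_rate (RhW08.Lens1Coverage.restSuccBotQ_of_resS
      (RhW08.Lens1Coverage.regRes8S_of_regHungCut10S (RhW08.Lens1Pinning.regHungCut10S_of_topPinning hP hU)))
    (restRateBotPQ_half_of_creditNet κ hA hB)

/-- ★★★ (K) §3 the read-back OF RECORD at `κ₀ = 1/2`: `TopPinning`, `RegUmbrella11S`, `EmptyNetLawHalfQ`, `CrowdedCreditLawHalfQ` ⊢ the crux decl by name. -/
theorem law421R_of_creditNet_half (hP : RhW08.Lens1Pinning.TopPinning) (hU : RhW08.Lens1Pinning.RegUmbrella11S)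
    (hA : EmptyNetLawHalfQ) (hB : CrowdedCreditLawHalfQ) :
    Summit.RiemannHypothesis.RiemannHypothesis.Theses.EarlyAppointments.TiltedLandingLaw421R :=
  law421R_of_creditNet hP hU (1 / 2) hA hB

/-! ## §4 (K) honesty: the target is exactly the κ-free SUM of the two laws' left sides -/

/-- (K) §4 the net cost splits over the two tent classes with nothing left over. -/
theorem netCostQ_all_eq_empty_add_crowded (η : ℝ) (f : ℂ → ℂ) (x₀ s hmax R Hs : ℝ) (B k : ℕ) :
    netCostQ AllLevelsQ η f x₀ s hmax R Hs B k
      = netCostQ EmptyTrkDQ η f x₀ s hmax R Hs B k + netCostQ CrowdedQ η f x₀ s hmax R Hs B k := by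
  rw [netCostQ_split EmptyTrkDQ AllLevelsQ, netCostQ_rest_eq_zero, add_zero]
  rfl

/-- ★ (K) §4 **THE TARGET IS THE SUM LAW**: `RestRateBotPQ halfPurse` ⟺ on every legal frame the half slack is non-negative and, after every
charged level, (empty-tent net cost) + (crowded net cost) ≤ `slackPQ halfPurse + creditsQ`.  LAW A(κ) ∧ LAW B(κ) splits this one inequality
into two with fixed shares — a strengthening, not a restatement. -/
theorem restRateBotPQ_half_iff_sum : RestRateBotPQ halfPurse ↔
    ∀ (η : ℝ) (f : ℂ → ℂ) (x₀ s hmax R Hs : ℝ) (B : ℕ), EngineHyps5 2 η f x₀ s hmax R Hs B →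
      0 ≤ slackPQ halfPurse η f x₀ s hmax R Hs B ∧
      ∀ k : ℕ, Charged (PTrkSQ PBot) StTrkDQ ReadyR2 η f x₀ s hmax R Hs B k →
        netCostQ EmptyTrkDQ η f x₀ s hmax R Hs B (k + 1) + netCostQ CrowdedQ η f x₀ s hmax R Hs B (k + 1)
          ≤ slackPQ halfPurse η f x₀ s hmax R Hs B + creditsQ η f x₀ s hmax R Hs B (k + 1) := by
  rw [restRateBotPQ_iff_books_step]
  refine forall_congr' fun η => forall_congr' fun f => forall_congr' fun x₀ => forall_congr' fun s =>
    forall_congr' fun hmax => forall_congr' fun R => forall_congr' fun Hs => forall_congr' fun B => forall_congr' fun _ => ?_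
  refine and_congr Iff.rfl (forall_congr' fun k => forall_congr' fun _ => ?_)
  rw [netCostQ_all_eq_empty_add_crowded]

end RhW08.CreditBooks
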